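import Summits.Ventures.PercRepro.GenQProfileFacts
import Summits.Ventures.PercRepro.Night2CoreFlatFive
import Summits.Ventures.PercRepro.RankLevelSetPlaneSix
import Summits.Ventures.PercRepro.GenQHighLayersAll

/-!
# PercRepro — the `(8, 6)` cell: the bounds and the hypotheses of the core (night-4, gen 4)

The certificates of the `(8, 6)` cell (`Night4T{t}C{d}Q6M0Z`, `Night4TrT{t}C{d}Q5M{m}Z`) are stated on a simple matroid
with lines `≤ 3`, planes `≤ 6`, solids `≤ 10` and rank-`5` flats `≤ 21` points.  This file supplies what their assembly
over a Core matroid needs: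

* `card_le_fortythree_of_core_of_ten`: `f(6) ≤ 2·f(5) + 1 ≤ 43` once `f(4) ≤ 10` (night-3's cover, night-2's
  `card_le_twentyone_of_core_of_ten`);
* `DFq_eq_Nq_of_card_le`, `Jq_nonneg_of_card_le`: at corank `≤ t − 1` every set is demand-free, so `0 ≤ J_t`
  (`t ≤ q + 2`);
* `CoreHyps`: the five hypotheses of the certificates, `coreHyps_of_core` deriving them from `Core M p` and the
  named input `f(4) ≤ 10`;
* `EightSixTopWindow`: the type-`5` balance on the coloop-free rank-`6` flats with `14 ≤ |G| ≤ 19` — the window the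
  profile LP does not certify (the precise residue of the row's top layer).

Imports `GenQProfileFacts`, `Night2CoreFlatFive`, `RankLevelSetPlaneSix` (planes `≤ 6` on the core) and
`GenQHighLayersAll` (`HighLayersCoreFree`, `TraceSumsCore`).
-/
namespace PercRepro.Night4

open Finset ThmH SixFour GenQ PerFlat Star NightThree ThmN

section general

variable {α : Type*} [DecidableEq α] {M : Matroid α} [M.Finite]

/-! ## Small coranks: every set is demand-free -/

/-- At corank `≤ t − 1` every rank-`q` subset of `G` is demand-free at type `t`: `DF_t = N_q`. -/
theorem DFq_eq_Nq_of_card_le {G : Finset α} {q t : ℕ} (hcard : G.card + 1 ≤ q + t) :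
    DFq M G q t = Nq M G q := by
  unfold DFq Nq
  rw [Finset.filter_true_of_mem]
  intro S hS
  have hS' := mem_Rq.1 hS
  have h0 : S.card ≤ G.card := Finset.card_le_card hS'.1
  have h1 : q ≤ S.card := le_card_of_eRk_eq hS'.2
  have h2 : (G \ S).card = G.card - S.card := Finset.card_sdiff_of_subset hS'.1
  have h3 : (G \ S).card + 1 ≤ t := by omega
  have h4 : M.eRk ((G \ S : Finset α) : Set α) ≤ ((G \ S).card : ℕ∞) := by
    have := M.eRk_le_encard ((G \ S : Finset α) : Set α)
    rwa [Set.encard_coe_eq_coe_finsetCard] at this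
  have h5 : ((G \ S).card : ℕ∞) + 1 ≤ (t : ℕ∞) := by exact_mod_cast h3
  calc M.eRk ((G \ S : Finset α) : Set α) + 1 ≤ ((G \ S).card : ℕ∞) + 1 := by gcongr
    _ ≤ (t : ℕ∞) := h5

/-- **The type-`t` balance at corank `≤ t − 1`** (`t ≤ q + 2`): `(q+1)·J_t = Σ_S (q+1)(q+2−t)·w_∞(S) ≥ 0`. -/
theorem Jq_nonneg_of_card_le {G : Finset α} {q t : ℕ} (ht : t ≤ q + 2) (hcard : G.card + 1 ≤ q + t) :
    0 ≤ Jq M G q t := by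
  have hpos : (0 : ℚ) < (q : ℚ) + 1 := by positivity
  suffices h : 0 ≤ ((q : ℚ) + 1) * Jq M G q t from le_of_mul_le_mul_left (by rw [mul_zero]; exact h) hpos
  rw [Jq_mul_succ_eq, DFq_eq_Nq_of_card_le hcard]
  unfold Nq
  rw [Finset.card_eq_sum_ones, Nat.cast_sum, Finset.mul_sum, ← Finset.sum_add_distrib]
  apply Finset.sum_nonneg
  intro S _
  have hw := wInf_pos (M := M) S
  have ht' : (t : ℚ) ≤ (q : ℚ) + 2 := by exact_mod_cast ht
  have h1 : (0 : ℚ) ≤ (q : ℚ) + 1 := by linarith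
  have h2 : (0 : ℚ) ≤ (q : ℚ) + 2 - t := by linarith
  have h3 := mul_nonneg (mul_nonneg h1 h2) hw.le
  push_cast
  linarith

end general

section core

variable {α : Type} [DecidableEq α] {M : Matroid α} [M.Finite]

/-! ## The rank-`6` flats of the core -/

/-- **`f(6) ≤ 2·f(5) + 1`**: if every rank-`4` flat of the core has `≤ 10` points, every rank-`6` flat has `≤ 43`. -/
theorem card_le_fortythree_of_core_of_ten {p : ℕ} (hc : Core M p)
    (h10 : ∀ F ∈ flatsQ M 4, F.card ≤ 10) {F : Finset α} (hF : F ∈ flatsQ M 6) : F.card ≤ 43 := by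
  rcases F.eq_empty_or_nonempty with hemp | ⟨e, he⟩
  · rw [hemp, Finset.card_empty]
    omega
  obtain ⟨F₁, F₂, r₁, r₂, hr₁, hr₂, hF₁, hF₂, _, _, hcov⟩ := exists_cover_erase_of_core hc hF he
  have hpart : ∀ (r : ℕ) (G : Finset α), r < 6 → G ∈ flatsQ M r → G.card ≤ 21 := by
    intro r G hr hG
    rcases (show r = 5 ∨ r = 4 ∨ r ≤ 3 by omega) with h5 | h4 | h3
    · subst h5
      exact card_le_twentyone_of_core_of_ten hc h10 hG
    · subst h4
      exact (h10 G hG).trans (by norm_num)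
    · have h := card_add_one_le_two_pow_of_core hc r G hG
      have h8 : 2 ^ r ≤ 2 ^ 3 := Nat.pow_le_pow_right (by norm_num) h3
      omega
  have h1 := hpart r₁ F₁ hr₁ hF₁
  have h2 := hpart r₂ F₂ hr₂ hF₂
  have hcard : F.card = (F.erase e).card + 1 := by rw [Finset.card_erase_add_one he]
  have hle : (F.erase e).card ≤ F₁.card + F₂.card :=
    (Finset.card_le_card hcov).trans (Finset.card_union_le _ _)
  omega

/-! ## The hypotheses of the certificates on the core -/

/-- The five hypotheses of the `(8, 6)` certificates: simple, lines `≤ 3`, planes `≤ 6`, solids `≤ 10`, rank-`5`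
flats `≤ 21`. -/
def CoreHyps (M : Matroid α) [M.Finite] : Prop :=
  Simple M ∧ (∀ L ∈ flatsQ M 2, L.card ≤ 3) ∧ (∀ P ∈ flatsQ M 3, P.card ≤ 6) ∧
    (∀ F ∈ flatsQ M 4, F.card ≤ 10) ∧ (∀ F ∈ flatsQ M 5, F.card ≤ 21)

/-- **A Core matroid with `f(4) ≤ 10` satisfies the five hypotheses**: simple and lines `≤ 3` (`Core`), planes `≤ 6`
(night-1's `ncard_le_six_of_eRk_le_three_of_free` on the `e`-free clause), solids `≤ 10` (the named input),
rank-`5` flats `≤ 21` (`card_le_twentyone_of_core_of_ten`). -/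
theorem coreHyps_of_core {p : ℕ} (hc : Core M p) (h10 : ∀ F ∈ flatsQ M 4, F.card ≤ 10) : CoreHyps M := by
  refine ⟨simple_of_core hc, fun _ hL => card_le_three_of_line_of_core hc hL, ?_, h10,
    fun _ hF => card_le_twentyone_of_core_of_ten hc h10 hF⟩
  intro P hP
  have hP' := mem_flatsQ.1 hP
  have hPE : (P : Set α) ⊆ M.E := by
    rw [← coe_gr M]
    exact Finset.coe_subset.2 hP'.1
  have hr3 : M.eRk (P : Set α) ≤ 3 := by
    rw [hP'.2.2]
    rfl
  have h := ncard_le_six_of_eRk_le_three_of_free M hc.2.2.2 hPE hr3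
  rwa [Set.ncard_coe_finset] at h

end core

/-! ## The residue of the top layer -/

/-- **The top-layer window of the `(8, 6)` row**: the type-`5` balance on the coloop-free rank-`6` flats of rank-`8`
Core matroids with `14 ≤ |G| ≤ 19` — the coranks `8 … 13` at which the profile LP (with the line, plane, solid and
rank-`5` rows and the trace-pair / trace-triple rows) admits a negative profile; every other corank is a dual
certificate. -/
def EightSixTopWindow : Prop :=
  ∀ {β : Type} [DecidableEq β] (M : Matroid β) [M.Finite] (G : Finset β), Core M 8 → G ∈ flatsQ M 6 →
    mTr M G = 0 → 14 ≤ G.card → G.card ≤ 19 → 0 ≤ Jq M G 6 5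

end PercRepro.Night4
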